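import Literature.Analysis.FluidPDE.WholeSpaceIBP
import Summits.NavierStokesRegularity.NavierStokesRegularity.Theorems.ThreadingFluxCentreJetDefs
import HarnessLib

/-!
# Sphere-free Gauss–Green on balls and shells for radial weights — tools
# (crux `PoloidalLiouville`, stmt-NavierStokesRegularity-1222, W1; crux idea «centre-virial», ns-idea-15 g9)

Generic calculus serving the centre-virial line (and reusable by the silent-shells / E0 point-source identities): Mathlib has
no divergence theorem on balls, so ball and shell fluxes are produced from WHOLE-SPACE integration by parts (tree
`integral_mul_divergence_add_eq_zero_left`) against radial test functions of the SQUARED radius, and a dominated-convergence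
passage to kinked profiles.  This file holds the smooth identity and the approximation gadgets:

* `integral_radialProfile_mul_divergence` — `∫ κ(|y|²) div V = −2 ∫ κ′(|y|²) ⟪V, y⟫` for `V ∈ C¹`, `κ ∈ C¹` vanishing far
  out (`y = x − x₀`; no condition at the centre thanks to the `|y|²`-parametrisation);
* `trap α β n` — continuous trapezoids converging pointwise EVERYWHERE to the indicator of `(α, β]`, eventually constant at
  every point (`tendsto_trap` and the `trap_eq_*` / `eventually_trap_*` lemmas);
* `tendsto_integral_mul_trap` — `∫_σ^{β+1} ζ·trap_n → ∫_{max σ α}^{β} ζ` for continuous `ζ`, `σ ≤ β`;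
* `shellDensity α` — a continuous extension to `ℝ` of `(3/2)τ^{-5/2}` on `[α, ∞)` (typed with `√`), with primitive
  `−(τ√τ)⁻¹` (`hasDerivAt_neg_inv_mul_sqrt`) and `∫_σ^β shellDensity α = (σ√σ)⁻¹ − (β√β)⁻¹` (`integral_shellDensity`).

The ball/shell identity itself is `ball_shell_flux` in `ThreadingFluxCentreVirialBallFlux.lean`.  Folklore analysis
(Evans, PDE, App. C.2); nothing here refers to Navier–Stokes; NS regularity is NOT proved.
`--supports stmt-NavierStokesRegularity-1222 --as helper`.  Filed by ns-wall-eng-4 g6 (cell ns-wall-extremal).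
[cite: Leray1934, §6 (1.11) p. 203]
-/

-- the summit and its single sub-problem share the name (CONVENTIONS §1)
set_option linter.dupNamespace false

noncomputable section

namespace Summit.NavierStokesRegularity.NavierStokesRegularity.Theorems.PoloidalLiouville.CentreVirial

open Set Function MeasureTheory Filter Topology
open Literature.Analysis.FluidPDE
open Literature.Analysis.FluidPDE.VectorCalculus (divergence)
open Summit.NavierStokesRegularity.NavierStokesRegularity.Theorems.PoloidalLiouville.CentreJet (E3)
open scoped RealInnerProductSpace

/-- **Radial integration by parts (smooth profile).**  For `V ∈ C¹(ℝ³; ℝ³)`, a centre `x₀` and a `C¹` profile `κ` of the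
SQUARED radius vanishing beyond `S`, the test function `θ(x) = κ(|x − x₀|²)` is `C¹` with compact support and
`∇θ = 2κ′(|y|²) y`, so whole-space integration by parts (`∫ θ div V + ∫ ⟪V, ∇θ⟫ = 0`, tree
`integral_mul_divergence_add_eq_zero_left`) reads `∫ κ(|y|²) div V = −2 ∫ κ′(|y|²) ⟪V, y⟫` (`y = x − x₀`).
Parametrising by `|y|²` rather than `|y|` keeps `θ` smooth at the centre with no condition on `κ` near `0`. -/
theorem integral_radialProfile_mul_divergence {V : E3 → E3} (hV : ContDiff ℝ 1 V) (x₀ : E3) {κ : ℝ → ℝ}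
    (hκ : ContDiff ℝ 1 κ) {S : ℝ} (hS : ∀ σ, S ≤ σ → κ σ = 0) :
    ∫ x, κ (‖x - x₀‖ ^ 2) * divergence V x = -2 * ∫ x, deriv κ (‖x - x₀‖ ^ 2) * ⟪V x, x - x₀⟫ := by
  set θ : E3 → ℝ := fun x => κ (‖x - x₀‖ ^ 2) with hθ_def
  have hns : ContDiff ℝ 1 fun x : E3 => ‖x - x₀‖ ^ 2 := (contDiff_id.sub contDiff_const).norm_sq ℝ
  have hθ : ContDiff ℝ 1 θ := hκ.comp hns
  have hθc : HasCompactSupport θ := by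
    refine HasCompactSupport.intro (isCompact_closedBall x₀ (|S| + 1)) fun x hx => ?_
    rw [Metric.mem_closedBall, dist_eq_norm, not_le] at hx
    apply hS
    have h1 : 1 ≤ ‖x - x₀‖ := by linarith [abs_nonneg S]
    nlinarith [le_abs_self S]
  have hgrad : ∀ x, ⟪V x, gradient θ x⟫ = 2 * (deriv κ (‖x - x₀‖ ^ 2) * ⟪V x, x - x₀⟫) := by
    intro x
    have h1 : HasFDerivAt (fun x : E3 => x - x₀) (ContinuousLinearMap.id ℝ E3) x :=
      (hasFDerivAt_id x).sub_const x₀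
    have h2 := h1.norm_sq
    have h3 : HasDerivAt κ (deriv κ (‖x - x₀‖ ^ 2)) (‖x - x₀‖ ^ 2) :=
      (hκ.differentiable one_ne_zero _).hasDerivAt
    have h4 := h3.comp_hasFDerivAt x h2
    rw [← real_inner_comm, gradient, InnerProductSpace.toDual_symm_apply,
      show θ = κ ∘ fun x : E3 => ‖x - x₀‖ ^ 2 from rfl, h4.fderiv]
    simp only [_root_.FunLike.coe_smul, Pi.smul_apply, ContinuousLinearMap.comp_apply,
      ContinuousLinearMap.id_apply, innerSL_apply_apply, smul_eq_mul]
    rw [real_inner_comm]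
    ring
  have h := integral_mul_divergence_add_eq_zero_left hθ hV hθc
  simp_rw [hgrad] at h
  rw [integral_const_mul] at h
  linarith

/-- The continuous trapezoid `trap α β n`: `= 0` on `(-∞, α]`, `= 1` on `[α + 1/(n+1), β]`, `= 0` on `[β + 1/(n+1), ∞)`,
linear in between.  It converges pointwise EVERYWHERE to the indicator of the half-open interval `(α, β]` and is
eventually constant at every point. -/
def trap (α β : ℝ) (n : ℕ) (τ : ℝ) : ℝ :=
  max 0 (min 1 (min (((n : ℝ) + 1) * (τ - α)) (((n : ℝ) + 1) * (β - τ) + 1)))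

/-- The trapezoid is continuous. -/
theorem continuous_trap (α β : ℝ) (n : ℕ) : Continuous (trap α β n) := by
  unfold trap
  fun_prop

/-- `0 ≤ trap`. -/
theorem trap_nonneg (α β : ℝ) (n : ℕ) (τ : ℝ) : 0 ≤ trap α β n τ := le_max_left _ _

/-- `trap ≤ 1`. -/
theorem trap_le_one (α β : ℝ) (n : ℕ) (τ : ℝ) : trap α β n τ ≤ 1 :=
  max_le zero_le_one (min_le_left _ _)

/-- `trap = 0` on `(-∞, α]`. -/
theorem trap_eq_zero_of_le {α β : ℝ} (n : ℕ) {τ : ℝ} (h : τ ≤ α) : trap α β n τ = 0 := by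
  unfold trap
  have hn : (0 : ℝ) < (n : ℝ) + 1 := by positivity
  have h1 : ((n : ℝ) + 1) * (τ - α) ≤ 0 := mul_nonpos_of_nonneg_of_nonpos hn.le (by linarith)
  have h2 : min 1 (min (((n : ℝ) + 1) * (τ - α)) (((n : ℝ) + 1) * (β - τ) + 1)) ≤ 0 :=
    (min_le_right _ _).trans ((min_le_left _ _).trans h1)
  exact le_antisymm (max_le le_rfl h2) (le_max_left _ _)

/-- `trap = 0` on `[β + 1/(n+1), ∞)`. -/
theorem trap_eq_zero_of_ge {α β : ℝ} (n : ℕ) {τ : ℝ} (h : β + 1 / ((n : ℝ) + 1) ≤ τ) : trap α β n τ = 0 := by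
  unfold trap
  have hn : (0 : ℝ) < (n : ℝ) + 1 := by positivity
  have h0 : 1 / ((n : ℝ) + 1) * ((n : ℝ) + 1) = 1 := by field_simp
  have h1 : ((n : ℝ) + 1) * (β - τ) + 1 ≤ 0 := by nlinarith
  have h2 : min 1 (min (((n : ℝ) + 1) * (τ - α)) (((n : ℝ) + 1) * (β - τ) + 1)) ≤ 0 :=
    (min_le_right _ _).trans ((min_le_right _ _).trans h1)
  exact le_antisymm (max_le le_rfl h2) (le_max_left _ _)

/-- In particular `trap = 0` on `[β + 1, ∞)`. -/
theorem trap_eq_zero_of_ge_add_one {α β : ℝ} (n : ℕ) {τ : ℝ} (h : β + 1 ≤ τ) : trap α β n τ = 0 := by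
  refine trap_eq_zero_of_ge n (le_trans ?_ h)
  have hn : (1 : ℝ) ≤ (n : ℝ) + 1 := by
    have : (0 : ℝ) ≤ n := Nat.cast_nonneg n
    linarith
  have : 1 / ((n : ℝ) + 1) ≤ 1 := by
    rw [div_le_one (by positivity)]
    exact hn
  linarith

/-- Pointwise limit of the trapezoids: eventually `1` on `(α, β]`. -/
theorem eventually_trap_eq_one {α β τ : ℝ} (h1 : α < τ) (h2 : τ ≤ β) :
    ∀ᶠ n : ℕ in atTop, trap α β n τ = 1 := by
  obtain ⟨N, hN⟩ := exists_nat_gt (1 / (τ - α))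
  refine Filter.eventually_atTop.2 ⟨N, fun n hn => ?_⟩
  unfold trap
  have hα : 0 < τ - α := by linarith
  have hn' : (N : ℝ) ≤ n := by exact_mod_cast hn
  have hA : 1 ≤ ((n : ℝ) + 1) * (τ - α) := by
    have : 1 / (τ - α) * (τ - α) = 1 := by field_simp
    nlinarith
  have hB : 1 ≤ ((n : ℝ) + 1) * (β - τ) + 1 := by
    have : (0 : ℝ) ≤ ((n : ℝ) + 1) * (β - τ) := mul_nonneg (by positivity) (by linarith)
    linarith
  rw [min_eq_left (le_min hA hB), max_eq_right zero_le_one]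

/-- Pointwise limit of the trapezoids: eventually `0` above `β`. -/
theorem eventually_trap_eq_zero {α β τ : ℝ} (h : β < τ) :
    ∀ᶠ n : ℕ in atTop, trap α β n τ = 0 := by
  obtain ⟨N, hN⟩ := exists_nat_gt (1 / (τ - β))
  refine Filter.eventually_atTop.2 ⟨N, fun n hn => trap_eq_zero_of_ge n ?_⟩
  have hβ : 0 < τ - β := by linarith
  have hn' : (N : ℝ) < (n : ℝ) + 1 := by
    have : (N : ℝ) ≤ n := by exact_mod_cast hn
    linarith
  have h1 : 1 / ((n : ℝ) + 1) < τ - β := by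
    rw [div_lt_iff₀ (by positivity)]
    have h2 : 1 / (τ - β) * (τ - β) = 1 := by field_simp
    nlinarith
  linarith

/-- The trapezoids converge pointwise to the indicator of `(α, β]`. -/
theorem tendsto_trap (α β τ : ℝ) :
    Tendsto (fun n : ℕ => trap α β n τ) atTop (𝓝 (Set.indicator (Set.Ioc α β) (fun _ => (1 : ℝ)) τ)) := by
  by_cases h : τ ∈ Set.Ioc α β
  · rw [Set.indicator_of_mem h]
    exact tendsto_const_nhds.congr' ((eventually_trap_eq_one h.1 h.2).mono fun n hn => hn.symm)
  · rw [Set.indicator_of_notMem h]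
    rw [Set.mem_Ioc, not_and_or, not_lt, not_le] at h
    rcases h with h | h
    · exact tendsto_const_nhds.congr' (Eventually.of_forall fun n => (trap_eq_zero_of_le n h).symm)
    · exact tendsto_const_nhds.congr' ((eventually_trap_eq_zero h).mono fun n hn => hn.symm)

/-- **Radial profiles against a continuous density: the limit profile.**  For a continuous `ζ` and `σ ≤ β`,
`∫_σ^{β+1} ζ · trap_n → ∫_{max σ α}^{β} ζ` (dominated convergence on the interval; the trapezoids tend to the indicator of
`(α, β]`). -/
theorem tendsto_integral_mul_trap {ζ : ℝ → ℝ} (hζ : Continuous ζ) {α β σ : ℝ} (hαβ : α ≤ β) (hσ : σ ≤ β) :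
    Tendsto (fun n : ℕ => ∫ τ in σ..(β + 1), ζ τ * trap α β n τ) atTop
      (𝓝 (∫ τ in (max σ α)..β, ζ τ)) := by
  have hlim : ∫ τ in (max σ α)..β, ζ τ = ∫ τ in σ..(β + 1), (Set.Ioc α β).indicator ζ τ := by
    rw [intervalIntegral.integral_of_le (by linarith : σ ≤ β + 1), setIntegral_indicator measurableSet_Ioc,
      Set.Ioc_inter_Ioc, min_eq_right (by linarith : β ≤ β + 1),
      intervalIntegral.integral_of_le (max_le hσ hαβ)]
  rw [hlim]
  refine intervalIntegral.tendsto_integral_filter_of_dominated_convergence (fun τ => |ζ τ|) ?_ ?_ ?_ ?_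
  · exact Eventually.of_forall fun n =>
      (hζ.mul (continuous_trap α β n)).aestronglyMeasurable
  · refine Eventually.of_forall fun n => Eventually.of_forall fun τ _ => ?_
    rw [Real.norm_eq_abs, abs_mul, abs_of_nonneg (trap_nonneg α β n τ)]
    exact mul_le_of_le_one_right (abs_nonneg _) (trap_le_one α β n τ)
  · exact hζ.abs.intervalIntegrable _ _
  · refine Eventually.of_forall fun τ _ => ?_
    have h := (tendsto_trap α β τ).const_mul (ζ τ)
    refine h.congr' (Eventually.of_forall fun n => rfl) |>.trans ?_
    by_cases hτ : τ ∈ Set.Ioc α β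
    · rw [Set.indicator_of_mem hτ, Set.indicator_of_mem hτ, mul_one]
    · rw [Set.indicator_of_notMem hτ, Set.indicator_of_notMem hτ, mul_zero]

/-- The shell density `ζ_α(τ) = 3 / (2 τ'² √τ')`, `τ' = max τ α` — a continuous extension to `ℝ` of `(3/2) τ^{-5/2}` on
`[α, ∞)` (`α > 0`), whose primitive there is `−(τ√τ)⁻¹ = −τ^{-3/2}`. -/
def shellDensity (α τ : ℝ) : ℝ := 3 / (2 * (max τ α) ^ 2 * Real.sqrt (max τ α))

/-- The shell density is continuous on `ℝ` (`α > 0`). -/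
theorem continuous_shellDensity {α : ℝ} (hα : 0 < α) : Continuous (shellDensity α) := by
  unfold shellDensity
  refine continuous_const.div ((continuous_const.mul ((continuous_id.max continuous_const).pow 2)).mul
    ((continuous_id.max continuous_const).sqrt)) fun τ => ?_
  have h1 : 0 < max τ α := lt_max_of_lt_right hα
  have h2 : 0 < Real.sqrt (max τ α) := Real.sqrt_pos.2 h1
  positivity

/-- The primitive: `d/dτ (−(τ√τ)⁻¹) = 3 / (2 τ² √τ)` for `τ > 0`. -/
theorem hasDerivAt_neg_inv_mul_sqrt {τ : ℝ} (hτ : 0 < τ) :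
    HasDerivAt (fun s : ℝ => -(s * Real.sqrt s)⁻¹) (3 / (2 * τ ^ 2 * Real.sqrt τ)) τ := by
  have hs : 0 < Real.sqrt τ := Real.sqrt_pos.2 hτ
  have hss : Real.sqrt τ ^ 2 = τ := Real.sq_sqrt hτ.le
  have h1 : HasDerivAt (fun s : ℝ => s * Real.sqrt s) (1 * Real.sqrt τ + τ * (1 / (2 * Real.sqrt τ))) τ :=
    (hasDerivAt_id τ).mul (Real.hasDerivAt_sqrt hτ.ne')
  have h2 := (h1.inv (by positivity : τ * Real.sqrt τ ≠ 0)).neg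
  have key : -(-(1 * Real.sqrt τ + τ * (1 / (2 * Real.sqrt τ))) / (τ * Real.sqrt τ) ^ 2) =
      3 / (2 * τ ^ 2 * Real.sqrt τ) := by
    have hne : Real.sqrt τ ≠ 0 := hs.ne'
    have hτne : τ ≠ 0 := hτ.ne'
    field_simp
    nlinarith [hss]
  rw [← key]
  exact h2

/-- `∫_σ^β ζ_α = (σ√σ)⁻¹ − (β√β)⁻¹` for `α ≤ σ ≤ β`, `0 < α`. -/
theorem integral_shellDensity {α σ β : ℝ} (hα : 0 < α) (hσ : α ≤ σ) (hσβ : σ ≤ β) :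
    ∫ τ in σ..β, shellDensity α τ = (σ * Real.sqrt σ)⁻¹ - (β * Real.sqrt β)⁻¹ := by
  have h := intervalIntegral.integral_eq_sub_of_hasDerivAt (f := fun s : ℝ => -(s * Real.sqrt s)⁻¹)
    (f' := shellDensity α) (a := σ) (b := β) ?_ ((continuous_shellDensity hα).intervalIntegrable _ _)
  · rw [h]; ring
  · intro τ hτ
    rw [Set.uIcc_of_le hσβ] at hτ
    have hτ0 : 0 < τ := lt_of_lt_of_le hα (hσ.trans hτ.1)
    have hmax : max τ α = τ := max_eq_left (hσ.trans hτ.1)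
    have := hasDerivAt_neg_inv_mul_sqrt hτ0
    unfold shellDensity
    rw [hmax]
    exact this

end Summit.NavierStokesRegularity.NavierStokesRegularity.Theorems.PoloidalLiouville.CentreVirial
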